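import Summits.BirchSwinnertonDyer.BirchSwinnertonDyer.Theorems.KolyvaginRankRigidityAtTwoWalkBridge
import Summits.BirchSwinnertonDyer.BirchSwinnertonDyer.Theorems.KolyvaginRankRigidityAtTwoWalkStepGoodLocal
import Summits.BirchSwinnertonDyer.BirchSwinnertonDyer.Theorems.KolyvaginRankRigidityAtTwoWalkEngineAdapterG
import Summits.BirchSwinnertonDyer.BirchSwinnertonDyer.Theorems.KolyvaginRankRigidityAtTwoWalkFrameAlgebra
import HarnessLib

/-!
# Crux U1 `KolyvaginBoundedDefectAtTwo` (stmt-BirchSwinnertonDyer-28083), LINE 17 `regular_core_rigidity`,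
# stub S1b `stub_nearCoreExistenceAtTwo` — THE WALK, part 1: the GOOD STEP at frame level

Width seat `bsd-line-krr2-p2` g15 (ONE READER on S1b); `--supports stmt-BirchSwinnertonDyer-28083` (helper).
THEOREMS ONLY; nothing here proves S1b, U1, a rung or BSD. BSD is NOT proved.

## The frame (S1-READER-g14 §Addendum B, structure-theorem-free)
Level `2^k`, vertex `S = H_{𝓕(c)} = modifiedSelmerGroup W K ι 2^k c` (`c` square-free, every prime factor a
Zhang–Kolyvagin prime at `2` of index `≥ k+1`). A FRAME is a family `g : Fin m → H¹(K, E[2^k])` of `τ_*`-EIGENCLASSES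
(`τ_* gᵢ = sgᵢ • gᵢ`, `sgᵢ = ±1`) together with an ALIVE set `A ⊆ Fin m` (`gᵢ ∈ S` for `i ∈ A`) and two exponents:
* (F3, exponent `J`) every `u ∈ S` satisfies `res_{k+1}(2^J u − ∑_{i∈A} bᵢ gᵢ) = 0` for some `b` (restriction to
  `Γ_{K(E[2^(k+1)])}`, i.e. `2^J S ⊆ ⟨g_A⟩ + ker res_{k+1}`);
* (F4, exponent `d`) `res_{k+1}(∑_{i∈A} bᵢ gᵢ) = 0 ⇒ 2^(k−d) ∣ bᵢ` for `i ∈ A` (independence modulo the inflation kernel).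
## The good step (`walkStep_good`)
Given alive indices `i₁ ≠ i₂` of signs `+1`, `−1`: the engine (`exists_regular_kolyvaginPrime_killing_gc`, p693309)
supplies a REGULAR Kolyvagin prime `ℓ > bnd`, `ℓ ∤ c`, of index `≥ k+1`, killing `gᵢ` (`i ∈ A ∖ {i₁,i₂}`) at `λ ∣ ℓ` and
cutting `p = g_{i₁}`, `q = g_{i₂}` with `ord loc_λ = ord` modulo the killed classes, hence (F4) `≥ 2^(k−d)`. At the new
vertex `S' = H_{𝓕(cℓ)}`: the killed classes survive (loc `= 0`), `2^(d+1) S' ⊆ S` (`two_pow_nsmul_mem_of_oppositeCut`,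
p691735), and the cut coefficients die at `λ` by OPPOSITE-SIGN SEPARATION (`Kum_λ ∩ 𝒯_λ = 0`, `τ_*`-eigenvectors of
opposite signs meet in `2`-torsion) — so (F3) holds for `S'` with the alive set `A ∖ {i₁, i₂}` and exponent
`J + 2d + 2`, and (F4) is inherited with the same `d`. [cite: MazurRubin2004, §4.1, Prop. 4.1.5; Cor. 2.7.3]
[cite: Jetchev2008, Lemma 5.2, Prop. 5.3] [cite: GrossLMS1991, §9]
Design: no definitions; `K : Type`; axioms `propext`, `Classical.choice`, `Quot.sound`.
-/

set_option autoImplicit false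
-- the Theorems namespace of this sub repeats the summit name by design (D-0017 nested layout)
set_option linter.dupNamespace false

noncomputable section

open scoped Classical
open Function NumberField IsDedekindDomain WeierstrassCurve Field Finset
open Literature.NumberTheory.EllipticCurves Literature.NumberTheory.EllipticCurves.Jetchev2008
open Literature.NumberTheory.EllipticCurves.KolyvaginPairing
open Literature.NumberTheory.GaloisRepresentations Literature.NumberTheory.GaloisCohomology
open Literature.NumberTheory.GaloisRepresentations.DiscreteGaloisModule (transverseSubgroup SelmerStructure)
open Literature.NumberTheory.Automorphic
open Summit.BirchSwinnertonDyer.Rank1Residual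
open Summit.BirchSwinnertonDyer.Rank1Residual.JET.SelmerVocabulary
open Summit.BirchSwinnertonDyer.Rank1Residual.JET.GlobalDuality (smul_place_eq_self_of_natCast_mem)
open Summit.BirchSwinnertonDyer.BirchSwinnertonDyer.Theorems.KolyvaginLowerBoundAtTwo (torsionFixing_le_of_dvd)

namespace Summit.BirchSwinnertonDyer.BirchSwinnertonDyer.Theorems.KolyvaginAtTwo.RegularWalk

variable {K : Type} [Field K] [NumberField K] (W : WeierstrassCurve ℚ) [W.IsElliptic] [W.IsGloballyMinimal]

/-! ### §3 The good step -/

/-- **THE GOOD STEP OF THE REGULAR-PRIME WALK** (frame level; see the module docstring for the frame (F3)/(F4)).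
From a vertex `H_{𝓕(c)}` carrying a frame with alive `τ_*`-eigenclasses `g_{i₁}` (sign `+1`) and `g_{i₂}` (sign `−1`),
`i₁ ≠ i₂`: beyond any bound there is a REGULAR Zhang–Kolyvagin prime `ℓ ∤ c` at `2` of index `≥ k+1` such that at
`H_{𝓕(cℓ)}` the remaining alive classes survive, (F3) holds with exponent `J + 2d + 2`, and (F4) holds with the same
`d`. Inputs: the engine adapter (p693309), the opposite cut `2^(d+1) H_{𝓕(cℓ)} ⊆ H_{𝓕(c)}` (p691735), survivors
(p686806), Φ-kill (p689128), `Kum_λ ∩ 𝒯_λ = 0` (p672833), Sah at `2`. [cite: MazurRubin2004, §4.1, Prop. 4.1.5]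
[cite: Jetchev2008, Lemma 5.2, proof of Prop. 5.3] [cite: GrossLMS1991, §9 Prop. 9.1] -/
theorem walkStep_good (k : ℕ) (hk : 1 ≤ k)
    (e : geomTorsion (W.baseChange K) ((2 ^ k : ℕ) : ℤ) → geomTorsion (W.baseChange K) ((2 ^ k : ℕ) : ℤ) →
      AlgebraicClosure K)
    (hμ : ∀ S T, e S T ^ (2 ^ k) = 1)
    (hadd₁ : ∀ S₁ S₂ T, e (S₁ + S₂) T = e S₁ T * e S₂ T)
    (hadd₂ : ∀ S T₁ T₂, e S (T₁ + T₂) = e S T₁ * e S T₂)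
    (hgal : ∀ (γ : absoluteGaloisGroup K) (S T : geomTorsion (W.baseChange K) ((2 ^ k : ℕ) : ℤ)),
      γ • e S T = e (γ • S) (γ • T))
    (halt : ∀ T, e T T = 1) (hnondeg : ∀ T, (∀ S, e S T = 1) → T = 0)
    (inv : LocalInvariants K (2 ^ k)) (hperf : inv.IsPerfect) (hvan : inv.SumLocalTermEqZero)
    (hK : IsImaginaryQuadratic K) (hD : NumberField.discr K < -4) (hodd : Odd (NumberField.discr K))
    (ι : K →+* ℂ) [∀ j : ℕ, NumberField (ringClassField K ι j)] [NeZero (W.conductorNorm ℤ)]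
    (hH : SatisfiesHeegnerHypothesis (W.conductorNorm ℤ) K)
    (hρ2 : W.HasSurjectiveModNGaloisRep 2) (hsurj : W.HasSurjectiveModNGaloisRep ((2 ^ (k + 1) : ℕ) : ℤ))
    {τ : K ≃ₐ[ℚ] K} (hτ1 : τ ≠ 1)
    -- the current vertex
    {c : ℕ} (hc : Squarefree c)
    (hkol : ∀ ℓ ∈ c.primeFactors, Zhang2014.IsKolyvaginPrime (W.conductorNorm ℤ) W K 2 ℓ)
    (hkM : ∀ ℓ ∈ c.primeFactors, k + 1 ≤ Zhang2014.kolyvaginIndex W 2 ℓ)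
    -- the frame
    {m : ℕ} (g : Fin m → galH1Torsion (W.baseChange K) ((2 ^ k : ℕ) : ℤ))
    (sg : Fin m → ℤ) (A : Finset (Fin m))
    (hgS : ∀ i ∈ A, g i ∈ modifiedSelmerGroup W K ι ((2 ^ k : ℕ) : ℤ) c)
    (hgτ : ∀ i, conjAct W τ ((2 ^ k : ℕ) : ℤ) (g i) = sg i • g i)
    {J d : ℕ}
    (hF3 : ∀ u : galH1Torsion (W.baseChange K) ((2 ^ k : ℕ) : ℤ), u ∈ modifiedSelmerGroup W K ι ((2 ^ k : ℕ) : ℤ) c →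
      ∃ b : Fin m → ℤ, ∀ ρ ∈ torsionFixing (W.baseChange K) ((2 ^ (k + 1) : ℕ) : ℤ),
        h1Eval (W.baseChange K) ((2 ^ k : ℕ) : ℤ) (((2 : ℤ) ^ J) • u - ∑ i ∈ A, b i • g i) ρ = 0)
    (hF4 : ∀ b : Fin m → ℤ, (∀ ρ ∈ torsionFixing (W.baseChange K) ((2 ^ (k + 1) : ℕ) : ℤ),
        h1Eval (W.baseChange K) ((2 ^ k : ℕ) : ℤ) (∑ i ∈ A, b i • g i) ρ = 0) → ∀ i ∈ A, (2 : ℤ) ^ (k - d) ∣ b i)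
    {i₁ i₂ : Fin m} (hi₁ : i₁ ∈ A) (hi₂ : i₂ ∈ A) (hne : i₁ ≠ i₂) (hs₁ : sg i₁ = 1) (hs₂ : sg i₂ = -1)
    (bnd : ℕ) :
    ∃ ℓ : ℕ, bnd < ℓ ∧ ¬ ℓ ∣ c ∧ Zhang2014.IsKolyvaginPrime (W.conductorNorm ℤ) W K 2 ℓ ∧
      k + 1 ≤ Zhang2014.kolyvaginIndex W 2 ℓ ∧
      (∃ (v₁ : HeightOneSpectrum (𝓞 ℚ)) (𝔓₁ : Ideal (absIntegers (𝓞 ℚ) ℚ)) (h : absoluteGaloisGroup ℚ),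
        (ℓ : 𝓞 ℚ) ∈ v₁.asIdeal ∧ 𝔓₁ ∈ v₁.primesAbove ∧ IsArithFrobAt (𝓞 ℚ) h 𝔓₁ ∧
        (∀ X : geomTorsion W ((2 ^ k : ℕ) : ℤ), h • h • X = X) ∧
        ∃ P : geomTorsion W ((2 ^ k : ℕ) : ℤ), (2 : ℤ) ^ (k - 1) • (P + h • P) ≠ 0) ∧
      (∀ i ∈ (A.erase i₁).erase i₂, g i ∈ modifiedSelmerGroup W K ι ((2 ^ k : ℕ) : ℤ) (c * ℓ)) ∧
      (∀ u : galH1Torsion (W.baseChange K) ((2 ^ k : ℕ) : ℤ),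
        u ∈ modifiedSelmerGroup W K ι ((2 ^ k : ℕ) : ℤ) (c * ℓ) → ∃ b : Fin m → ℤ,
        ∀ ρ ∈ torsionFixing (W.baseChange K) ((2 ^ (k + 1) : ℕ) : ℤ),
          h1Eval (W.baseChange K) ((2 ^ k : ℕ) : ℤ)
            (((2 : ℤ) ^ (J + 2 * d + 2)) • u - ∑ i ∈ (A.erase i₁).erase i₂, b i • g i) ρ = 0) ∧
      (∀ b : Fin m → ℤ, (∀ ρ ∈ torsionFixing (W.baseChange K) ((2 ^ (k + 1) : ℕ) : ℤ),
          h1Eval (W.baseChange K) ((2 ^ k : ℕ) : ℤ) (∑ i ∈ (A.erase i₁).erase i₂, b i • g i) ρ = 0) →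
        ∀ i ∈ (A.erase i₁).erase i₂, (2 : ℤ) ^ (k - d) ∣ b i) := by
  classical
  -- instances
  haveI : NeZero (2 ^ k) := ⟨pow_ne_zero k two_ne_zero⟩
  haveI hEK : (W.baseChange K).IsElliptic := by rw [baseChange]; infer_instance
  haveI : Finite (geomTorsion (W.baseChange K) ((2 ^ k : ℕ) : ℤ)) :=
    finite_geomTorsion_of_neZero (W.baseChange K) (2 ^ k)
  set S := modifiedSelmerGroup W K ι ((2 ^ k : ℕ) : ℤ) c with hSdef
  haveI : Finite S := finite_modifiedSelmerGroup W ι (n := ((2 ^ k : ℕ) : ℤ)) (by positivity) hc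
  have hSτ : ∀ x ∈ S, conjAct W τ ((2 ^ k : ℕ) : ℤ) x ∈ S := fun x hx ↦
    conjAct_mem_modifiedSelmerGroup W hK ι k hc hx τ
  -- the alive set after the step and the kill list
  set A' := (A.erase i₁).erase i₂ with hA'
  have hA'A : A' ⊆ A := (Finset.erase_subset _ _).trans (Finset.erase_subset _ _)
  have hi₁A' : i₁ ∉ A' := fun h ↦ Finset.notMem_erase i₁ A (Finset.mem_of_mem_erase h)
  have hi₂A' : i₂ ∉ A' := Finset.notMem_erase i₂ _
  have hi₂' : i₂ ∈ A.erase i₁ := Finset.mem_erase.mpr ⟨hne.symm, hi₂⟩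
  have hsplit : ∀ f : Fin m → galH1Torsion (W.baseChange K) ((2 ^ k : ℕ) : ℤ),
      ∑ i ∈ A, f i = f i₁ + (f i₂ + ∑ i ∈ A', f i) := fun f ↦ by
    rw [← Finset.add_sum_erase A f hi₁, ← Finset.add_sum_erase (A.erase i₁) f hi₂']
  let y : Fin m → galH1Torsion (W.baseChange K) ((2 ^ k : ℕ) : ℤ) := fun i ↦ if i ∈ A' then g i else 0
  have hy : ∀ i, y i ∈ S := fun i ↦ by
    by_cases hi : i ∈ A'
    · simp only [y, if_pos hi]; exact hgS i (hA'A hi)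
    · simp only [y, if_neg hi]; exact S.zero_mem
  have hyτ : ∀ i, conjAct W τ ((2 ^ k : ℕ) : ℤ) (y i) = sg i • y i := fun i ↦ by
    by_cases hi : i ∈ A'
    · simp only [y, if_pos hi]; exact hgτ i
    · simp only [y, if_neg hi]
      rw [zsmul_zero]
      exact map_zero (conjAct W τ ((2 ^ k : ℕ) : ℤ))
  have hsumy : ∀ b : Fin m → ℤ, ∑ i, b i • y i = ∑ i ∈ A', b i • g i := fun b ↦ sum_smul_indicator g A' b
  -- the eigenclasses to cut
  have hpτ : conjAct W τ ((2 ^ k : ℕ) : ℤ) (g i₁) = (1 : ℤ) • g i₁ := by rw [hgτ, hs₁]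
  have hqτ : conjAct W τ ((2 ^ k : ℕ) : ℤ) (g i₂) = (-1 : ℤ) • g i₂ := by rw [hgτ, hs₂]
  -- THE ENGINE
  haveI : Finite (↥(show AddSubgroup (galH1Torsion (W.baseChange K) ((2 ^ k : ℕ) : ℤ)) from S)) := ‹Finite S›
  obtain ⟨ℓ, hℓbnd, hKol, hidx, hreg, hloc⟩ :=
    RegularValueEngine.exists_regular_kolyvaginPrime_killing W hK hodd hH hk hρ2 hsurj hτ1
      (show AddSubgroup (galH1Torsion (W.baseChange K) ((2 ^ k : ℕ) : ℤ)) from S) hSτ y hy sg hyτ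
      (hgS i₁ hi₁) (hgS i₂ hi₂) hpτ hqτ (max bnd c)
  have hbnd : bnd < ℓ := lt_of_le_of_lt (le_max_left _ _) hℓbnd
  have hcℓlt : c < ℓ := lt_of_le_of_lt (le_max_right _ _) hℓbnd
  have hℓP : ℓ.Prime := hKol.1
  have hℓc : ¬ ℓ ∣ c := fun h ↦ absurd hcℓlt (not_lt.mpr (Nat.le_of_dvd (Nat.pos_of_ne_zero hc.ne_zero) h))
  have hcℓ : Squarefree (c * ℓ) :=
    Nat.squarefree_mul_iff.mpr ⟨((Nat.Prime.coprime_iff_not_dvd hℓP).mpr hℓc).symm, hc, hℓP.squarefree⟩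
  have hpf : (c * ℓ).primeFactors = insert ℓ c.primeFactors := by
    rw [Nat.primeFactors_mul hc.ne_zero hℓP.ne_zero, hℓP.primeFactors, Finset.union_comm, ← Finset.insert_eq]
  have hkol' : ∀ ℓ' ∈ (c * ℓ).primeFactors, Zhang2014.IsKolyvaginPrime (W.conductorNorm ℤ) W K 2 ℓ' := by
    intro ℓ' h
    rw [hpf, Finset.mem_insert] at h
    rcases h with rfl | h
    · exact hKol
    · exact hkol ℓ' h
  have hkM' : ∀ ℓ' ∈ (c * ℓ).primeFactors, k + 1 ≤ Zhang2014.kolyvaginIndex W 2 ℓ' := by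
    intro ℓ' h
    rw [hpf, Finset.mem_insert] at h
    rcases h with rfl | h
    · exact hidx
    · exact hkM ℓ' h
  have hℓmem : ℓ ∈ (c * ℓ).primeFactors := by rw [hpf]; exact Finset.mem_insert_self _ _
  -- the place `λ ∣ ℓ`
  obtain ⟨v, hv⟩ := exists_place_natCast_mem_of_kolyvaginPrime W hKol
  have hfix : τ • v = v := smul_place_eq_self_of_natCast_mem τ hℓP.ne_zero hKol.2.2.2.2.1 v hv
  have hvc : v ∈ placesDividing K (c * ℓ) := RegularRefill.mem_placesDividing_of_mem_primeFactors hcℓ hℓmem v hv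
  obtain ⟨hkill, hcutp, hcutq⟩ := hloc v hv
  -- `loc_v` re-typed on `H¹(K, E[2^k])` in the `galH1Torsion` spelling (the spelling of `h1Eval` and `conjAct`)
  let loc : galH1Torsion (W.baseChange K) ((2 ^ k : ℕ) : ℤ) →+
      galoisCohomology (((W.baseChange K).torsionGaloisModule ((2 ^ k : ℕ) : ℤ)).toLocal (Sum.inr v : Place K)) 1 :=
    galoisCohomology.localization ((W.baseChange K).torsionGaloisModule ((2 ^ k : ℕ) : ℤ)) (Sum.inr v : Place K) 1
  have hkill' : ∀ i, loc (y i) = 0 := fun i ↦ hkill i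
  have hcutp' : ∀ a : ℤ, a • loc (g i₁) = 0 → ∃ b : Fin m → ℤ,
      ∀ ρ ∈ torsionFixing (W.baseChange K) ((2 ^ (k + 1) : ℕ) : ℤ),
        h1Eval (W.baseChange K) ((2 ^ k : ℕ) : ℤ) (a • g i₁ - ∑ i, b i • y i) ρ = 0 := fun a ha ↦ (hcutp a).mp ha
  have hcutq' : ∀ a : ℤ, a • loc (g i₂) = 0 → ∃ b : Fin m → ℤ,
      ∀ ρ ∈ torsionFixing (W.baseChange K) ((2 ^ (k + 1) : ℕ) : ℤ),
        h1Eval (W.baseChange K) ((2 ^ k : ℕ) : ℤ) (a • g i₂ - ∑ i, b i • y i) ρ = 0 := fun a ha ↦ (hcutq a).mp ha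
  -- the structure-level description of the two vertices
  let 𝒯' : SelmerStructure ((W.baseChange K).torsionGaloisModule ((2 ^ k : ℕ) : ℤ)) := fun w ↦ match w with
    | Sum.inl _ => ⊤
    | Sum.inr w => ⨅ ℓ' ∈ (c * ℓ).primeFactors.filter (fun ℓ' : ℕ ↦ ((ℓ' : ℕ) : 𝓞 K) ∈ w.asIdeal),
        ⨅ (w' : HeightOneSpectrum (𝓞 (ringClassField K ι ℓ'))) (_ : w'.asIdeal.LiesOver w.asIdeal),
          letI := (adicCompletionOfLiesOver K (ringClassField K ι ℓ') w w').toAlgebra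
          transverseSubgroup (GaloisRep.toLocal w ((W.baseChange K).torsionGaloisModule ((2 ^ k : ℕ) : ℤ)))
            (w'.adicCompletion (ringClassField K ι ℓ'))
  have h𝒯' : ∀ w : HeightOneSpectrum (𝓞 K), 𝒯' (Sum.inr w) =
      ⨅ ℓ' ∈ (c * ℓ).primeFactors.filter (fun ℓ' : ℕ ↦ ((ℓ' : ℕ) : 𝓞 K) ∈ w.asIdeal),
        ⨅ (w' : HeightOneSpectrum (𝓞 (ringClassField K ι ℓ'))) (_ : w'.asIdeal.LiesOver w.asIdeal),
          letI := (adicCompletionOfLiesOver K (ringClassField K ι ℓ') w w').toAlgebra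
          transverseSubgroup (GaloisRep.toLocal w ((W.baseChange K).torsionGaloisModule ((2 ^ k : ℕ) : ℤ)))
            (w'.adicCompletion (ringClassField K ι ℓ')) := fun w ↦ rfl
  set 𝓛 := selmerF W ((2 ^ k : ℕ) : ℤ) 𝒯' (placesDividing K (c * ℓ)) with h𝓛def
  have hS'eq : 𝓛.selmerGroup = modifiedSelmerGroup W K ι ((2 ^ k : ℕ) : ℤ) (c * ℓ) :=
    selmerGroup_selmerF_eq_modifiedSelmerGroup_of_dvd W ι _ hcℓ dvd_rfl 𝒯' h𝒯'
  have hSeq : SelmerStructure.selmerGroup (Function.update 𝓛 (Sum.inr v : Place K)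
        ((W.baseChange K).kummerSelmerStructure ((2 ^ k : ℕ) : ℤ) (Sum.inr v : Place K)) :
        SelmerStructure ((W.baseChange K).torsionGaloisModule ((2 ^ k : ℕ) : ℤ))) = S :=
    selmerGroup_update_kummer_eq_modifiedSelmerGroup W ι _ hcℓ hℓP hKol.2.2.2.2.1 hv 𝒯' h𝒯'
  have h𝓛v : 𝓛 (Sum.inr v) = 𝒯' (Sum.inr v) := by rw [h𝓛def, selmerF_inr, if_pos hvc]
  -- membership transfer helpers
  have hmemS : ∀ {x : galH1Torsion (W.baseChange K) ((2 ^ k : ℕ) : ℤ)}, x ∈ S →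
      x ∈ SelmerStructure.selmerGroup (Function.update 𝓛 (Sum.inr v : Place K)
      ((W.baseChange K).kummerSelmerStructure ((2 ^ k : ℕ) : ℤ) (Sum.inr v : Place K)) :
      SelmerStructure ((W.baseChange K).torsionGaloisModule ((2 ^ k : ℕ) : ℤ))) := fun hx ↦ by rwa [hSeq]
  have hlocKum : ∀ {x : galH1Torsion (W.baseChange K) ((2 ^ k : ℕ) : ℤ)}, x ∈ S →
      loc x ∈ (W.baseChange K).kummerSelmerStructure ((2 ^ k : ℕ) : ℤ) (Sum.inr v) := fun {x} hx ↦ by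
    have h := (SelmerStructure.mem_selmerGroup_iff _ _).mp (hmemS hx) (Sum.inr v)
    rwa [Function.update_self] at h
  have hlocT : ∀ {x : galH1Torsion (W.baseChange K) ((2 ^ k : ℕ) : ℤ)},
      x ∈ modifiedSelmerGroup W K ι ((2 ^ k : ℕ) : ℤ) (c * ℓ) → loc x ∈ 𝒯' (Sum.inr v) := fun {x} hx ↦ by
    rw [← hS'eq] at hx
    have h := (SelmerStructure.mem_selmerGroup_iff _ _).mp hx (Sum.inr v)
    rwa [h𝓛v] at h
  have hdisj : ((W.baseChange K).kummerSelmerStructure ((2 ^ k : ℕ) : ℤ) (Sum.inr v : Place K)) ⊓ 𝒯' (Sum.inr v) = ⊥ :=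
    RegularRefill.kummer_inf_transverse_eq_bot_two W k hK hD ι hk (c * ℓ) hcℓ hkol' hkM' 𝒯' h𝒯' v hvc
  -- `2^k` kills everything
  have h2k' : ∀ x : galH1Torsion (W.baseChange K) ((2 ^ k : ℕ) : ℤ), (((2 ^ k : ℕ) : ℤ)) • x = 0 := fun x ↦
    zsmul_galH1Torsion_eq_zero (W.baseChange K) ((2 ^ k : ℕ) : ℤ) x
  have e2k : ((2 : ℤ) ^ k) = ((2 ^ k : ℕ) : ℤ) := by rw [Nat.cast_pow, Nat.cast_ofNat]
  have h2k : ∀ x : galH1Torsion (W.baseChange K) ((2 ^ k : ℕ) : ℤ), ((2 : ℤ) ^ k) • x = 0 := fun x ↦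
    (congrArg (· • x) e2k).trans (h2k' x)
  have h2kloc : ∀ x : galH1Torsion (W.baseChange K) ((2 ^ k : ℕ) : ℤ), (2 ^ k) • loc x = 0 := fun x ↦ by
    rw [← natCast_zsmul, ← map_zsmul, h2k', map_zero]
  -- the cut orders of `p = g i₁` and `q = g i₂`
  have hcut_of : ∀ {i₀ : Fin m}, i₀ ∈ A → i₀ ∉ A' →
      (∀ a : ℤ, a • loc (g i₀) = 0 → ∃ b : Fin m → ℤ, ∀ ρ ∈ torsionFixing (W.baseChange K) ((2 ^ (k + 1) : ℕ) : ℤ),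
        h1Eval (W.baseChange K) ((2 ^ k : ℕ) : ℤ) (a • g i₀ - ∑ i, b i • y i) ρ = 0) →
      ∀ a : ℤ, a • loc (g i₀) = 0 → (2 : ℤ) ^ (k - d) ∣ a := by
    intro i₀ hi₀ hi₀A' hcut a ha
    obtain ⟨b, hb⟩ := hcut a ha
    let B : Fin m → ℤ := fun i ↦ (if i = i₀ then a else 0) + (if i ∈ A' then -b i else 0)
    have hB : ∑ i ∈ A, B i • g i = a • g i₀ - ∑ i, b i • y i := by
      rw [hsumy, sub_eq_add_neg, ← Finset.sum_neg_distrib,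
        Finset.sum_congr rfl (fun i _ ↦ (neg_zsmul (g i) (b i)).symm)]
      exact sum_single_add_indicator_smul g hA'A hi₀ a (fun i ↦ -b i)
    have hres : ∀ ρ ∈ torsionFixing (W.baseChange K) ((2 ^ (k + 1) : ℕ) : ℤ),
        h1Eval (W.baseChange K) ((2 ^ k : ℕ) : ℤ) (∑ i ∈ A, B i • g i) ρ = 0 := fun ρ hρ ↦ by
      rw [hB]; exact hb ρ hρ
    have h := hF4 B hres i₀ hi₀
    simpa [B, hi₀A'] using h
  obtain ⟨j₁, hj₁d, hj₁k, hpord⟩ := exists_addOrderOf_eq_two_pow (h2kloc (g i₁)) (hcut_of hi₁ hi₁A' hcutp')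
  obtain ⟨j₂, hj₂d, hj₂k, hqord⟩ := exists_addOrderOf_eq_two_pow (h2kloc (g i₂)) (hcut_of hi₂ hi₂A' hcutq')
  -- survivors
  have hlocg : ∀ i ∈ A', loc (g i) = 0 := fun i hi ↦ by
    have h := hkill' i; simp only [y, if_pos hi] at h; exact h
  have hsurv : ∀ i ∈ A', g i ∈ modifiedSelmerGroup W K ι ((2 ^ k : ℕ) : ℤ) (c * ℓ) := by
    intro i hi
    rw [← hS'eq]
    exact RegularRefill.mem_selmerF_of_localization_eq_zero (W := W) (k := k) (c := c * ℓ) (𝒯 := 𝒯') (v := v) hvc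
      (hmemS (hgS i (hA'A hi))) (hlocg i hi)
  -- `2^(d+1) H_{𝓕(cℓ)} ⊆ H_{𝓕(c)}`
  have hback : ∀ u : galH1Torsion (W.baseChange K) ((2 ^ k : ℕ) : ℤ),
      u ∈ modifiedSelmerGroup W K ι ((2 ^ k : ℕ) : ℤ) (c * ℓ) → ((2 : ℤ) ^ (d + 1)) • u ∈ S := by
    intro u hu
    have hu' : u ∈ 𝓛.selmerGroup := by rw [hS'eq]; exact hu
    have hj : max j₁ j₂ ≤ k := max_le hj₁k hj₂k
    have hmem := RegularRefill.two_pow_nsmul_mem_of_oppositeCut (W := W) (k := k) (e := e) (hμ := hμ)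
      (hadd₁ := hadd₁) (hadd₂ := hadd₂) (hgal := hgal) (halt := halt) (hnondeg := hnondeg) (inv := inv) (hK := hK)
      (hD := hD) (ι := ι) (hk := hk) (c := c * ℓ) (hc := hcℓ) (hkol := hkol') (hkM := hkM') (𝒯 := 𝒯') (h𝒯 := h𝒯')
      (hperf := hperf) (hvan := hvan) (hℓc := hℓmem) (hreg := hreg) (v := v) (hv := hv) (hτ1 := hτ1) (hfix := hfix)
      (hjk := hj) (hj₁ := le_max_left j₁ j₂) (hj₂ := le_max_right j₁ j₂) (hp := hmemS (hgS i₁ hi₁))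
      (hq := hmemS (hgS i₂ hi₂)) (hpτ := hpτ) (hqτ := hqτ) (hpord := hpord) (hqord := hqord) (hu := hu')
    rw [hSeq, ← natCast_zsmul] at hmem
    have h2 := S.zsmul_mem hmem ((2 : ℤ) ^ (d - max j₁ j₂))
    rw [smul_smul] at h2
    have hsc : (2 : ℤ) ^ (d - max j₁ j₂) * ((2 ^ (max j₁ j₂ + 1) : ℕ) : ℤ) = (2 : ℤ) ^ (d + 1) := by
      rw [Nat.cast_pow, Nat.cast_ofNat, ← pow_add]
      congr 1
      have : max j₁ j₂ ≤ d := max_le hj₁d hj₂d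
      omega
    rw [hsc] at h2
    exact h2
  -- signs at `λ`
  have hpfix : conjActPlace W τ ((2 ^ k : ℕ) : ℤ) hfix (loc (g i₁)) = loc (g i₁) := by
    have h := conjActPlace_localization W τ ((2 ^ k : ℕ) : ℤ) hfix (g i₁)
    rw [hpτ, one_zsmul] at h
    exact h
  have hqneg : conjActPlace W τ ((2 ^ k : ℕ) : ℤ) hfix (loc (g i₂)) = -loc (g i₂) := by
    have h := conjActPlace_localization W τ ((2 ^ k : ℕ) : ℤ) hfix (g i₂)
    rw [hqτ, neg_one_zsmul] at h
    exact h.trans (map_neg loc (g i₂))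
  refine ⟨ℓ, hbnd, hℓc, hKol, hidx, hreg, hsurv, ?_, ?_⟩
  · -- (F3) at the new vertex
    intro u hu
    obtain ⟨b, hb⟩ := hF3 (((2 : ℤ) ^ (d + 1)) • u) (hback u hu)
    -- the element `w = 2^J (2^(d+1) u) - ∑_A bᵢ gᵢ` restricts to zero
    have hlocw : loc (((2 : ℤ) ^ J) • (((2 : ℤ) ^ (d + 1)) • u) - ∑ i ∈ A, b i • g i) = 0 :=
      localization_eq_zero_of_res_eq_zero W hK hKol hidx v hv hb
    have hlocbg : loc (∑ i ∈ A, b i • g i) = b i₁ • loc (g i₁) + b i₂ • loc (g i₂) := by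
      rw [hsplit, map_add, map_add, map_zsmul, map_zsmul, map_sum]
      rw [Finset.sum_eq_zero (fun i hi ↦ by rw [map_zsmul, hlocg i hi, smul_zero]), add_zero]
    -- the cut part is Kummer AND transverse, hence zero
    have hzero : b i₁ • loc (g i₁) + b i₂ • loc (g i₂) = 0 := by
      have hT : b i₁ • loc (g i₁) + b i₂ • loc (g i₂) ∈ 𝒯' (Sum.inr v) := by
        have h1 : loc (((2 : ℤ) ^ J) • (((2 : ℤ) ^ (d + 1)) • u)) ∈ 𝒯' (Sum.inr v) := by
          rw [map_zsmul, map_zsmul]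
          exact AddSubgroup.zsmul_mem _ (AddSubgroup.zsmul_mem _ (hlocT hu) _) _
        have h3 : loc (((2 : ℤ) ^ J) • (((2 : ℤ) ^ (d + 1)) • u) - ∑ i ∈ A, b i • g i) =
            loc (((2 : ℤ) ^ J) • (((2 : ℤ) ^ (d + 1)) • u)) - (b i₁ • loc (g i₁) + b i₂ • loc (g i₂)) := by
          rw [map_sub, hlocbg]
        rw [hlocw] at h3
        rw [(sub_eq_zero.mp h3.symm).symm]
        exact h1
      have hKu : b i₁ • loc (g i₁) + b i₂ • loc (g i₂) ∈
          (W.baseChange K).kummerSelmerStructure ((2 ^ k : ℕ) : ℤ) (Sum.inr v : Place K) :=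
        add_mem (AddSubgroup.zsmul_mem _ (hlocKum (hgS i₁ hi₁)) _) (AddSubgroup.zsmul_mem _ (hlocKum (hgS i₂ hi₂)) _)
      have h := AddSubgroup.mem_inf.mpr ⟨hKu, hT⟩
      rw [hdisj] at h
      exact (AddSubgroup.mem_bot).mp h
    -- opposite-sign separation: `2 b₁ loc p = 0`, `2 b₂ loc q = 0`
    have e1 : b i₁ • loc (g i₁) = -(b i₂ • loc (g i₂)) := eq_neg_of_add_eq_zero_left hzero
    have h2p : (2 * b i₁) • loc (g i₁) = 0 := by
      have e2 : conjActPlace W τ ((2 ^ k : ℕ) : ℤ) hfix (b i₁ • loc (g i₁)) = b i₁ • loc (g i₁) := by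
        rw [map_zsmul, hpfix]
      have e3 : conjActPlace W τ ((2 ^ k : ℕ) : ℤ) hfix (b i₁ • loc (g i₁)) = -(b i₁ • loc (g i₁)) := by
        rw [e1, map_neg, map_zsmul, hqneg, smul_neg, neg_neg]
      have e5 : b i₁ • loc (g i₁) = -(b i₁ • loc (g i₁)) := e2.symm.trans e3
      rw [← zsmul_zsmul_eq_mul_zsmul, two_zsmul]
      nth_rewrite 2 [e5]
      exact add_neg_cancel _
    have h2q : (2 * b i₂) • loc (g i₂) = 0 := by
      have e4 : b i₂ • loc (g i₂) = -(b i₁ • loc (g i₁)) := by rw [e1, neg_neg]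
      rw [← zsmul_zsmul_eq_mul_zsmul, e4, zsmul_neg, zsmul_zsmul_eq_mul_zsmul, h2p, neg_zero]
    -- hence `2^(d+1) bᵢ gᵢ = 0` for the two cut classes
    have hdvd₁ : (2 : ℤ) ^ k ∣ (2 : ℤ) ^ (d + 1) * b i₁ := by
      have h := two_pow_dvd_mul_of_zsmul_eq_zero hj₁k hpord h2p
      have e : (2 : ℤ) ^ (d + 1) * b i₁ = 2 ^ (d - j₁) * (2 ^ j₁ * (2 * b i₁)) := by
        rw [← mul_assoc, ← mul_assoc, ← pow_add, ← pow_succ]; congr 2; omega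
      rw [e]; exact dvd_mul_of_dvd_right h _
    have hdvd₂ : (2 : ℤ) ^ k ∣ (2 : ℤ) ^ (d + 1) * b i₂ := by
      have h := two_pow_dvd_mul_of_zsmul_eq_zero hj₂k hqord h2q
      have e : (2 : ℤ) ^ (d + 1) * b i₂ = 2 ^ (d - j₂) * (2 ^ j₂ * (2 * b i₂)) := by
        rw [← mul_assoc, ← mul_assoc, ← pow_add, ← pow_succ]; congr 2; omega
      rw [e]; exact dvd_mul_of_dvd_right h _
    have hkill₁ : ((2 : ℤ) ^ (d + 1) * b i₁) • g i₁ = 0 := RegularValueEngine.zsmul_eq_zero_of_dvd (h2k (g i₁)) hdvd₁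
    have hkill₂ : ((2 : ℤ) ^ (d + 1) * b i₂) • g i₂ = 0 := RegularValueEngine.zsmul_eq_zero_of_dvd (h2k (g i₂)) hdvd₂
    refine ⟨fun i ↦ (2 : ℤ) ^ (d + 1) * b i, fun ρ hρ ↦ ?_⟩
    have hexp : ((2 : ℤ) ^ (J + 2 * d + 2)) • u - ∑ i ∈ A', ((2 : ℤ) ^ (d + 1) * b i) • g i =
        ((2 : ℤ) ^ (d + 1)) • (((2 : ℤ) ^ J) • (((2 : ℤ) ^ (d + 1)) • u) - ∑ i ∈ A, b i • g i) := by
      rw [zsmul_sub, zsmul_finset_sum, hsplit]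
      simp_rw [zsmul_zsmul_eq_mul_zsmul]
      rw [hkill₁, hkill₂, zero_add, zero_add]
      have hsc2 : (2 : ℤ) ^ (d + 1) * ((2 : ℤ) ^ J * (2 : ℤ) ^ (d + 1)) = (2 : ℤ) ^ (J + 2 * d + 2) := by
        rw [← pow_add, ← pow_add]; congr 1; omega
      rw [hsc2]
    rw [hexp, res_zsmul W k _ _ hρ, hb ρ hρ, smul_zero]
  · -- (F4) at the new vertex is inherited
    intro b hb i hi
    let B : Fin m → ℤ := fun i ↦ if i ∈ A' then b i else 0
    have hB : ∑ i ∈ A, B i • g i = ∑ i ∈ A', b i • g i := by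
      simp only [B, ite_smul, zero_smul]
      rw [Finset.sum_ite_mem, Finset.inter_eq_right.mpr hA'A]
    have h := hF4 B (fun ρ hρ ↦ by rw [hB]; exact hb ρ hρ) i (hA'A hi)
    simpa [B, hi] using h

end Summit.BirchSwinnertonDyer.BirchSwinnertonDyer.Theorems.KolyvaginAtTwo.RegularWalk

end
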